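import Literature.Topology.FourManifolds.CobordismAttachment
import Literature.Topology.FourManifolds.BordismFourNullBordism
import Literature.Topology.FourManifolds.HCobordismWall
import HarnessLib

/-!
# `W ∪_ψ X` as a cobordism between the summands of a disjoint far end; h-cobordism pieces

Topic `Literature/Topology/FourManifolds`; in the cone of the named fact
`Literature.Topology.FourManifolds.isHCobordant_of_equivalent_intersectionForm` (**Wall 1964,
Thm. 2**; C. T. C. Wall, *On simply-connected 4-manifolds*, J. London Math. Soc. 39 (1964)
141–149; `HCobordismDonaldson.lean`). Wall's `R` is obtained from the bounded manifold
`R₀ = C ∪ V` (`∂R₀ = M₁ # (−M₂)`) by one more attachment whose far end is the disjoint union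
`M₁ ⊔ M₂` (p. 145: "We have now constructed a manifold `R` whose boundary components are `M₁` and
`M₂`"), and the first piece `C` is an h-cobordism. This file records the two pieces of
book-keeping this needs, for the tree's witness structures:

* `CobordismAttachment.toCobordismOfSum` — **an attachment `V = W ∪_ψ X` of a cobordism `X`
  from `P` to a disjoint union `M₁ ⊔ M₂` is a cobordism from `M₁` to `M₂`** with total space `V`
  (`∂V = jX (inr (M₁ ⊔ M₂))`, `CobordismAttachment.range_jX_comp_inr`; the ends are the
  restrictions of the smooth embedding `jX ∘ inr` to the open summands,
  `isSmoothEmbedding_comp_inl/inr`), with its ends computed (`toCobordismOfSum_inl/inr`) and the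
  induced maps on homology factored through `X` (`map_toCobordismOfSum_inlC`, `…_inrC`).
* `Cobordism.IsHCobordism.isIso_map_inl/inr` — **both ends of an h-cobordism induce
  isomorphisms on `Hₖ(-; ℤ)`** (the ends are homotopy equivalences by definition,
  `Cobordism.IsHCobordism`; Hatcher 2002, Cor. 2.11). (Simple connectivity of the total space is
  the tree's `Cobordism.IsHCobordism.simplyConnectedSpace`, `HCobordismFreedman.lean`.)

Everything is proved; the only definition is the structure-valued `toCobordismOfSum`; no named
fact is introduced.

## References

* C. T. C. Wall, *On simply-connected 4-manifolds*, J. London Math. Soc. 39 (1964) 141–149, §2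
  pp. 145–146. [WallJLMS1964]
* J. Milnor, *Lectures on the h-cobordism theorem*, Princeton (1965), §1, Def. 1.1, Thm. 1.4.
  [MilnorHCobordism1965]
* A. Hatcher, *Algebraic Topology*, CUP (2002), Cor. 2.11. [HatcherAT2002]
-/

open scoped Manifold ContDiff Topology
open Set Function Topology CategoryTheory
open Literature.AlgebraicTopology.SingularHomology

noncomputable section

universe u

namespace Literature.Topology.FourManifolds

/-! ### h-cobordism pieces -/

namespace Cobordism.IsHCobordism

variable {n : ℕ} {M N : Type u} [TopologicalSpace M] [ChartedSpace (EuclideanSpace ℝ (Fin n)) M]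
  [TopologicalSpace N] [ChartedSpace (EuclideanSpace ℝ (Fin n)) N] {c : Cobordism n M N}

/-- **The incoming end of an h-cobordism induces isomorphisms on `Hₖ(-; ℤ)`** (Hatcher 2002,
Cor. 2.11). [cite: HatcherAT2002, Cor. 2.11] -/
theorem isIso_map_inl (h : c.IsHCobordism) (k : ℕ) :
    IsIso (singularHomology.map ℤ ℤ (⟨c.inl, c.continuous_inl⟩ : C(M, c.W)) k) :=
  h.1.isIso_singularHomologyMap k

/-- **The outgoing end of an h-cobordism induces isomorphisms on `Hₖ(-; ℤ)`** (Hatcher 2002,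
Cor. 2.11). [cite: HatcherAT2002, Cor. 2.11] -/
theorem isIso_map_inr (h : c.IsHCobordism) (k : ℕ) :
    IsIso (singularHomology.map ℤ ℤ (⟨c.inr, c.continuous_inr⟩ : C(N, c.W)) k) :=
  h.2.isIso_singularHomologyMap k

end Cobordism.IsHCobordism

/-! ### An attachment with disjoint far end as a cobordism between the summands -/

namespace CobordismAttachment

variable {n : ℕ} {W : Type u} [TopologicalSpace W] [ChartedSpace (EuclideanHalfSpace (n + 1)) W]
  {P M₁ M₂ : Type u} [TopologicalSpace P] [ChartedSpace (EuclideanSpace ℝ (Fin n)) P]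
  [TopologicalSpace M₁] [ChartedSpace (EuclideanSpace ℝ (Fin n)) M₁]
  [TopologicalSpace M₂] [ChartedSpace (EuclideanSpace ℝ (Fin n)) M₂]
  [IsManifold (𝓡 n) ∞ M₁] [IsManifold (𝓡 n) ∞ M₂]
  {b : BoundaryData (𝓡∂ (n + 1)) W (𝓡 n)} {X : Cobordism n P (M₁ ⊕ M₂)}
  {ψ : b.carrier ≃ₘ⟮𝓡 n, 𝓡 n⟯ P} {V : Type u} [TopologicalSpace V] [T2Space V]
  [SecondCountableTopology V] [ChartedSpace (EuclideanHalfSpace (n + 1)) V]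
  [IsManifold (𝓡∂ (n + 1)) ∞ V] [CompactSpace V]

/-- **An attachment `V = W ∪_ψ X` of a cobordism `X` from `P` to `M₁ ⊔ M₂` is a cobordism from
`M₁` to `M₂` with total space `V`**: `∂V = jX (inr (M₁ ⊔ M₂))` splits into the two smoothly
embedded, disjoint pieces `jX ∘ inr ∘ Sum.inl` and `jX ∘ inr ∘ Sum.inr` (Milnor 1965, Def. 1.1 and
Thm. 1.4: the boundary of `W ∪_h W′` for the triads `(W; ∅, ∂W)`, `(W′; P, M₁ ⊔ M₂)` is
`M₁ ⊔ M₂`; Wall 1964, p. 145: "a manifold `R` whose boundary components are `M₁` and `M₂`").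
[cite: MilnorHCobordism1965, §1, Def. 1.1 and Thm. 1.4] [cite: WallJLMS1964, §2 p. 145] -/
def toCobordismOfSum (At : CobordismAttachment b X ψ V) : Cobordism n M₁ M₂ where
  W := V
  inl := At.jX ∘ X.inr ∘ Sum.inl
  inr := At.jX ∘ X.inr ∘ Sum.inr
  isSmoothEmbedding_inl := isSmoothEmbedding_comp_inl At.isSmoothEmbedding_jX_comp_inr
  isSmoothEmbedding_inr := isSmoothEmbedding_comp_inr At.isSmoothEmbedding_jX_comp_inr
  disjoint_range := by
    rw [Set.disjoint_iff]
    rintro _ ⟨⟨x, rfl⟩, ⟨y, hy⟩⟩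
    have h := At.isSmoothEmbedding_jX_comp_inr.isEmbedding.injective hy
    exact Sum.inr_ne_inl h
  range_inl_union_range_inr := by
    rw [← At.range_jX_comp_inr]
    ext v
    simp only [mem_union, mem_range, Function.comp_apply]
    constructor
    · rintro (⟨x, rfl⟩ | ⟨y, rfl⟩)
      · exact ⟨Sum.inl x, rfl⟩
      · exact ⟨Sum.inr y, rfl⟩
    · rintro ⟨x | y, rfl⟩
      · exact Or.inl ⟨x, rfl⟩
      · exact Or.inr ⟨y, rfl⟩

/-- The total space of `toCobordismOfSum` is `V`. [folklore] -/
@[simp] theorem toCobordismOfSum_W (At : CobordismAttachment b X ψ V) : At.toCobordismOfSum.W = V :=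
  rfl

/-- The incoming end of `toCobordismOfSum` is `jX ∘ inr ∘ Sum.inl`. [folklore] -/
@[simp] theorem toCobordismOfSum_inl (At : CobordismAttachment b X ψ V) (x : M₁) :
    At.toCobordismOfSum.inl x = At.jX (X.inr (Sum.inl x)) :=
  rfl

/-- The outgoing end of `toCobordismOfSum` is `jX ∘ inr ∘ Sum.inr`. [folklore] -/
@[simp] theorem toCobordismOfSum_inr (At : CobordismAttachment b X ψ V) (y : M₂) :
    At.toCobordismOfSum.inr y = At.jX (X.inr (Sum.inr y)) :=
  rfl

/-- The incoming end of `toCobordismOfSum` as a continuous map factors through `X`: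
`inl = jX ∘ (inr ∘ Sum.inl)`. [folklore] -/
theorem toCobordismOfSum_inlC (At : CobordismAttachment b X ψ V) :
    (⟨At.toCobordismOfSum.inl, At.toCobordismOfSum.continuous_inl⟩ : C(M₁, V)) =
      (⟨At.jX, At.continuous_jX⟩ : C(X.W, V)).comp
        ⟨X.inr ∘ Sum.inl, X.continuous_inr.comp continuous_inl⟩ :=
  rfl

/-- The outgoing end of `toCobordismOfSum` as a continuous map factors through `X`:
`inr = jX ∘ (inr ∘ Sum.inr)`. [folklore] -/
theorem toCobordismOfSum_inrC (At : CobordismAttachment b X ψ V) :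
    (⟨At.toCobordismOfSum.inr, At.toCobordismOfSum.continuous_inr⟩ : C(M₂, V)) =
      (⟨At.jX, At.continuous_jX⟩ : C(X.W, V)).comp
        ⟨X.inr ∘ Sum.inr, X.continuous_inr.comp continuous_inr⟩ :=
  rfl

variable (R : Type u) [CommRing R] (A : Type u) [AddCommGroup A] [Module R A]

/-- **On homology the incoming end of `toCobordismOfSum` is `jX_* ∘ (inr ∘ Sum.inl)_*`**; in
particular it is onto as soon as `jX_*` is onto and `(inr ∘ Sum.inl)_* : Hₖ(M₁) → Hₖ(X)` is onto.
[folklore] -/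
theorem map_toCobordismOfSum_inlC (At : CobordismAttachment b X ψ V) (k : ℕ) :
    singularHomology.map R A
        (⟨At.toCobordismOfSum.inl, At.toCobordismOfSum.continuous_inl⟩ : C(M₁, V)) k =
      singularHomology.map R A (⟨X.inr ∘ Sum.inl, X.continuous_inr.comp continuous_inl⟩ :
          C(M₁, X.W)) k ≫
        singularHomology.map R A (⟨At.jX, At.continuous_jX⟩ : C(X.W, V)) k := by
  rw [toCobordismOfSum_inlC, singularHomology.map_comp]

/-- **On homology the outgoing end of `toCobordismOfSum` is `jX_* ∘ (inr ∘ Sum.inr)_*`.**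
[folklore] -/
theorem map_toCobordismOfSum_inrC (At : CobordismAttachment b X ψ V) (k : ℕ) :
    singularHomology.map R A
        (⟨At.toCobordismOfSum.inr, At.toCobordismOfSum.continuous_inr⟩ : C(M₂, V)) k =
      singularHomology.map R A (⟨X.inr ∘ Sum.inr, X.continuous_inr.comp continuous_inr⟩ :
          C(M₂, X.W)) k ≫
        singularHomology.map R A (⟨At.jX, At.continuous_jX⟩ : C(X.W, V)) k := by
  rw [toCobordismOfSum_inrC, singularHomology.map_comp]

end CobordismAttachment

end Literature.Topology.FourManifolds

end
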